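/-
Copyright (c) 2026 the pub-hodgecm-mathlib formalisation cell (harness21).  Prover seat hodgecm-mathlib-K2E3-p14 (g7), Track B «K2-LIT» ∕ h413
(`stmt-HodgeConjecture-24833`), line `K2_E3_EllipticInputs`, leaf (nsc-S-A′), brick (E4b) = discharge of `h3cell` of ★ E4a, part (E4b-1α′).  2026-09-04.
-/
import Summits.HodgeConjecture.HodgeConjecture.Theorems.K2E3GL3BorelInducedJacquetQFiltration   -- (E4b-1α) (this seat): filtration + closed cell at Levi level
import Literature.NumberTheory.Automorphic.GLReindex                                           -- ★ `reindexGL`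
import HarnessLib

/-!
# K2_E3 road (h413), leaf (nsc-S-A′), brick (E4b-1α′) — the closed `(B, P_{(2,1)})`-cell of `r_{(2,1)}(Ind_B^{GL₃} χδ^{1/2})` IN THE `GL₂`-BLOCK NORMAL FORM

Cell `pub/hodgecm-mathlib` (D-0151), Track B, seat K2E3-p14 (g7); architect K2E3-p25 (g2).  `--supports stmt-HodgeConjecture-24833 --as helper`; THEOREMS ONLY (no
definition ∕ instance ∕ notation ∕ named fact ∕ `sorry`); never imports `Cruxes/…/Lines`.  COUNT-NEUTRAL.

THE MATHEMATICS ([BernsteinZelevinsky1977, Thm. 5.2 (closed orbit)]; [Casselman1995, §6.3]).  `G = GL₃(F)`, `Q = P_{![0,0,1]} ⊇ B`, Levi `M = Π_a GL(block a) ≅ GL₂ × GL₁`,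
`I = I(χ) = Ind_B^G (χ∘levi)·δ_B^{1/2}` (★ `parabolicIndGL F id (𝟙.twist χ)`), `J = r_Q(I)` (★ `jacquetGL F ![0,0,1] I`).  A block embedding `ι : GL₂(F) → M` is any
homomorphism with `diag(ι g) = diag(g, 1)` (hypothesis `hι`; e.g. the architect's ★ `exists_blockEmbedding_twoOne`), continuous (`hιc`).
* §1 Bookkeeping for `ι`: `diag(ι b) ∈ B` for `b ∈ B₂`, `∈ U₃` for `b ∈ U₂`; every `m ∈ M` is `z · ι g` with `diag z = diag(1,1,d) ∈ B` (`exists_eq_mul_iota`).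
* §2 **`exists_closedCellMap_blockMap`** — THE CLOSED CELL IN THE NORMAL FORM of ★ (E4b-2■) `K2E3LeviPrincipalSeriesNoSupercuspidal.intertwiningMap_subrepresentation_eq_zero_of_blockMap`:
  there are a character `χ₂` of the diagonal torus of `GL₂` and a linear map `Ψ : J → I₂(χ₂) := parabolicIndGL F (id : Fin 2 → Fin 2) (𝟙.twist χ₂)` with
  `Ψ[f](g) = f(diag(ι g))`, `Ψ(ι(g)·x) = g·Ψ(x)`, and **`Ψ x = 0 ↔ x ∈ J₁`** (`J₁` = classes of functions vanishing on `Q`, (E4b-1α) §1).  `χ₂` is the tautological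
  character `t ↦ σ′(diag ι t)·δ_{B₂}^{-1/2}(t)` (so `σ′(diag ι b) = χ₂(levi b)·δ_{B₂}^{1/2}(b)` on `B₂` is a formal cancellation — no modulus is evaluated), and `Ψ` is
  (E4b-1α) `exists_closedCellMap` followed by restriction along `ι` (injective by §1).
HONEST LABEL: HC_CM is proved only modulo the 7 printed citations (2 remaining named inputs: hLiu418 = stmt-HodgeConjecture-24832, h413 = stmt-HodgeConjecture-24833)
until rung 0 closes; count-neutral helper.

## Mathlib ∕ tree search
★ (E4b-1α) `exists_closedCellMap`, `inducingChar_eq_one_of_mem_upperUnitriangular`; ★ `reindexGL`∕`reindexGL_apply` (GLReindex); ★ `blockDiagonalGL_apply_coe_dite`,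
★ `leviProjection_apply_coe`, ★ `coe_leviEmbeddingP`, ★ `leviProjection_leviEmbeddingP_apply`, ★ `rootDeltaChar_eq_one_of_mem_unipotentRadicalP`, ★ `mem_standardParabolicGL_iff`,
★ `mem_upperUnitriangular_iff`, ★ `isSmooth_smoothInd`, ★ `Representation.isSmoothVector_of_le`; Mathlib `MonoidHom.codRestrict`, `Representation.twist_apply`.
Dedup: `rg "closedCellMap_blockMap|exists_eq_mul_iota"` — no hits.

## References
* [BernsteinZelevinsky1977] I. N. Bernstein, A. V. Zelevinsky, *Induced representations of reductive p-adic groups I*, Ann. Sci. ÉNS 10 (1977), §2.3, Thm. 5.2.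
* [Casselman1995] W. Casselman, *Introduction to the theory of admissible representations of p-adic reductive groups* (draft 1995), §6.3, Prop. 6.3.1.
-/

set_option autoImplicit false
set_option linter.dupNamespace false

noncomputable section

open Function Representation
open scoped MatrixGroups

namespace Summit.HodgeConjecture.HodgeConjecture.Cruxes.H413.K2E3GL3BorelInducedJacquetQClosedCellGL2

open Literature.NumberTheory.Automorphic K2E3GL3BorelInducedJacquetQFiltration

variable {F : Type} [Field F]

/-! ## §1 Block bookkeeping for a block embedding `ι` with `diag(ι g) = diag(g,1)` -/

section Blocks

/-- Entries of `diag(m)` on a diagonal block are the entries of the block (any labelling). [cite: BernsteinZelevinsky1977, §2.1] -/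
theorem blockDiagonalGL_apply_block {n : ℕ} {α : Type*} [LinearOrder α] [Fintype α] (c : Fin n → α) (m : Π a, GL {i : Fin n // c i = a} F) (a : α)
    (i j : {k : Fin n // c k = a}) :
    ((blockDiagonalGL F c m : GL (Fin n) F) : Matrix (Fin n) (Fin n) F) i.1 j.1 = ((m a : GL {k : Fin n // c k = a} F) : Matrix _ _ F) i j := by
  rw [← coe_leviEmbeddingP, ← leviProjection_apply_coe, leviProjection_leviEmbeddingP_apply]

/-- Entries of `diag(m)` off the diagonal blocks vanish (any labelling). [cite: BernsteinZelevinsky1977, §2.1] -/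
theorem blockDiagonalGL_apply_of_ne {n : ℕ} {α : Type*} [LinearOrder α] [Fintype α] (c : Fin n → α) (m : Π a, GL {i : Fin n // c i = a} F) (i j : Fin n)
    (h : c i ≠ c j) : ((blockDiagonalGL F c m : GL (Fin n) F) : Matrix (Fin n) (Fin n) F) i j = 0 := by
  rw [blockDiagonalGL_apply_coe_dite, dif_neg h]

variable (ι : GL (Fin 2) F →* (Π a : Fin 2, GL {i : Fin 3 // (![0, 0, 1] : Fin 3 → Fin 2) i = a} F)) (hι : ∀ g : GL (Fin 2) F, (((blockDiagonalGL F (![0, 0, 1] : Fin 3 → Fin 2)) (ι g) : GL (Fin 3) F) : Matrix (Fin 3) (Fin 3) F) = !![(g : Matrix (Fin 2) (Fin 2) F) 0 0, (g : Matrix (Fin 2) (Fin 2) F) 0 1, 0; (g : Matrix (Fin 2) (Fin 2) F) 1 0, (g : Matrix (Fin 2) (Fin 2) F) 1 1, 0; 0, 0, 1])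
include hι

/-- `diag(ι b) ∈ B₃` for `b ∈ B₂`. [cite: BernsteinZelevinsky1977, §2.1] -/
theorem blockDiagonalGL_iota_mem_borel {b : GL (Fin 2) F} (hb : b ∈ (standardParabolicGL F (id : Fin 2 → Fin 2))) : ((blockDiagonalGL F (![0, 0, 1] : Fin 3 → Fin 2)) (ι b) : GL (Fin 3) F) ∈ (standardParabolicGL F (id : Fin 3 → Fin 3)) := by
  rw [mem_standardParabolicGL_iff] at hb ⊢
  have h10 : (b : Matrix (Fin 2) (Fin 2) F) 1 0 = 0 := hb (show (id : Fin 2 → Fin 2) 0 < (id : Fin 2 → Fin 2) 1 by decide)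
  intro i j hij
  rw [hι]
  fin_cases i <;> fin_cases j <;> first | exact absurd hij (by decide) | rfl | simp [h10]

/-- `diag(ι u) ∈ U₃` for `u ∈ U₂`. [cite: BernsteinZelevinsky1977, §2.1] -/
theorem blockDiagonalGL_iota_mem_upperUnitriangular {u : GL (Fin 2) F} (hu : u ∈ upperUnitriangular (Fin 2) F) :
    ((blockDiagonalGL F (![0, 0, 1] : Fin 3 → Fin 2)) (ι u) : GL (Fin 3) F) ∈ upperUnitriangular (Fin 3) F := by
  rw [mem_upperUnitriangular_iff] at hu ⊢
  obtain ⟨hbt, hdiag⟩ := hu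
  have h10 : (u : Matrix (Fin 2) (Fin 2) F) 1 0 = 0 := hbt (show (id : Fin 2 → Fin 2) 0 < (id : Fin 2 → Fin 2) 1 by decide)
  have h00 := hdiag 0
  have h11 := hdiag 1
  refine ⟨fun i j hij => ?_, fun i => ?_⟩
  · rw [hι]
    fin_cases i <;> fin_cases j <;> first | exact absurd hij (by decide) | rfl | simp [h10]
  · rw [hι]
    fin_cases i
    · simpa using h00
    · simpa using h11
    · rfl

/-- The `GL₁`-block of `ι g` is trivial. [cite: BernsteinZelevinsky1977, §2.1] -/
theorem iota_apply_one (g : GL (Fin 2) F) : ι g 1 = 1 := by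
  refine Units.ext (Matrix.ext fun i j => ?_)
  obtain ⟨i, hi⟩ := i
  obtain ⟨j, hj⟩ := j
  have hi2 : i = 2 := by fin_cases i <;> simp_all
  have hj2 : j = 2 := by fin_cases j <;> simp_all
  subst hi2; subst hj2
  rw [← blockDiagonalGL_apply_block (![0, 0, 1] : Fin 3 → Fin 2) (ι g) 1 ⟨2, hi⟩ ⟨2, hj⟩, hι, Units.val_one, Matrix.one_apply_eq]
  rfl

/-- **`M = M₁ · ι(GL₂)`**: every `m ∈ M` is `z · ι g` with `z` supported on the `GL₁`-block, so that `diag z ∈ B₃`. [cite: BernsteinZelevinsky1977, §2.1] -/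
theorem exists_eq_mul_iota (m : (Π a : Fin 2, GL {i : Fin 3 // (![0, 0, 1] : Fin 3 → Fin 2) i = a} F)) : ∃ (g : GL (Fin 2) F) (z : (Π a : Fin 2, GL {i : Fin 3 // (![0, 0, 1] : Fin 3 → Fin 2) i = a} F)), ((blockDiagonalGL F (![0, 0, 1] : Fin 3 → Fin 2)) z : GL (Fin 3) F) ∈ (standardParabolicGL F (id : Fin 3 → Fin 3)) ∧ m = z * ι g := by
  -- the index equivalence `Fin 2 ≃ block 0`
  have hval : ∀ i : {k : Fin 3 // (![0, 0, 1] : Fin 3 → Fin 2) k = 0}, ((i : Fin 3) : ℕ) < 2 := by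
    rintro ⟨i, hi⟩
    fin_cases i
    · exact Nat.zero_lt_two
    · exact Nat.one_lt_two
    · exact absurd hi (by decide)
  let e : Fin 2 ≃ {k : Fin 3 // (![0, 0, 1] : Fin 3 → Fin 2) k = 0} :=
    { toFun := fun j => ⟨Fin.castSucc j, by fin_cases j <;> rfl⟩
      invFun := fun i => ⟨((i : Fin 3) : ℕ), hval i⟩
      left_inv := fun j => Fin.ext (by simp)
      right_inv := fun i => Subtype.ext (Fin.ext (by simp)) }
  have he : ∀ j : Fin 2, ((e j : {k : Fin 3 // (![0, 0, 1] : Fin 3 → Fin 2) k = 0}) : Fin 3) = Fin.castSucc j := fun j => rfl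
  -- the block `m 0` as an element of `GL₂`
  let g : GL (Fin 2) F := (reindexGL e).symm (m 0)
  have hg0 : ι g 0 = m 0 := by
    refine Units.ext (Matrix.ext fun i j => ?_)
    rw [← blockDiagonalGL_apply_block (![0, 0, 1] : Fin 3 → Fin 2) (ι g) 0 i j, hι]
    obtain ⟨i', rfl⟩ := e.surjective i
    obtain ⟨j', rfl⟩ := e.surjective j
    have hm : ((m 0 : GL {k : Fin 3 // (![0, 0, 1] : Fin 3 → Fin 2) k = 0} F) : Matrix _ _ F) (e i') (e j') = (g : Matrix (Fin 2) (Fin 2) F) i' j' := by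
      show _ = ((reindexGL e.symm (m 0) : GL (Fin 2) F) : Matrix (Fin 2) (Fin 2) F) i' j'
      rw [coe_reindexGL, Matrix.reindex_apply, Matrix.submatrix_apply, Equiv.symm_symm]
    rw [hm, he, he]
    fin_cases i' <;> fin_cases j' <;> rfl
  refine ⟨g, m * (ι g)⁻¹, ?_, by rw [inv_mul_cancel_right]⟩
  -- `diag (m (ι g)⁻¹)` is diagonal outside the `GL₁`-block entry: it lies in `B₃`
  have hz0 : (m * (ι g)⁻¹) 0 = 1 := by rw [Pi.mul_apply, Pi.inv_apply, hg0, mul_inv_cancel]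
  rw [mem_standardParabolicGL_iff]
  intro i j hij
  by_cases hc : (![0, 0, 1] : Fin 3 → Fin 2) i = (![0, 0, 1] : Fin 3 → Fin 2) j
  · -- same block: both in block `0` (block `1` is a singleton, `j < i` impossible there)
    have hi0 : (![0, 0, 1] : Fin 3 → Fin 2) i = 0 := by
      fin_cases i <;> fin_cases j <;> first | exact absurd hij (by decide) | rfl | exact absurd hc (by decide)
    have hj0 : (![0, 0, 1] : Fin 3 → Fin 2) j = 0 := hc ▸ hi0
    rw [show i = (⟨i, hi0⟩ : {k : Fin 3 // (![0, 0, 1] : Fin 3 → Fin 2) k = 0}).1 from rfl, show j = (⟨j, hj0⟩ : {k : Fin 3 // (![0, 0, 1] : Fin 3 → Fin 2) k = 0}).1 from rfl,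
      blockDiagonalGL_apply_block, hz0, Units.val_one]
    have hne : (⟨i, hi0⟩ : {k : Fin 3 // (![0, 0, 1] : Fin 3 → Fin 2) k = 0}) ≠ ⟨j, hj0⟩ := fun h => (ne_of_gt hij) (congrArg Subtype.val h)
    rw [Matrix.one_apply_ne hne]
  · exact blockDiagonalGL_apply_of_ne (![0, 0, 1] : Fin 3 → Fin 2) _ i j hc

end Blocks

/-! ## §2 The closed cell in the `GL₂`-block normal form -/

section ClosedCell

variable [ValuativeRel F] [TopologicalSpace F] [IsNonarchimedeanLocalField F]
  (χ : (Π a : Fin 3, GL {i : Fin 3 // (id : Fin 3 → Fin 3) i = a} F) →* ℂˣ) (ι : GL (Fin 2) F →* (Π a : Fin 2, GL {i : Fin 3 // (![0, 0, 1] : Fin 3 → Fin 2) i = a} F)) (hι : ∀ g : GL (Fin 2) F, (((blockDiagonalGL F (![0, 0, 1] : Fin 3 → Fin 2)) (ι g) : GL (Fin 3) F) : Matrix (Fin 3) (Fin 3) F) = !![(g : Matrix (Fin 2) (Fin 2) F) 0 0, (g : Matrix (Fin 2) (Fin 2) F) 0 1, 0; (g : Matrix (Fin 2) (Fin 2) F)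 1 0, (g : Matrix (Fin 2) (Fin 2) F) 1 1, 0; 0, 0, 1]) (hιc : Continuous ι)
include hι

/-- **The tautological block character and the key identity** `σ′(diag ι b) = χ₂(levi b)·δ_{B₂}^{1/2}(b)` on `B₂`: with
`χ₂ = (χ∘levi₃∘diag∘ι∘emb₂)·(δ_{B₃}^{1/2}∘diag∘ι∘emb₂)·(δ_{B₂}^{1/2}∘emb₂)⁻¹` both sides kill the unipotent part of `b` and agree on its torus part by construction.
[cite: BernsteinZelevinsky1977, 1.8, §2.3] -/
theorem exists_blockChar_inducingChar_eq :
    ∃ χ₂ : (Π a : Fin 2, GL {i : Fin 2 // (id : Fin 2 → Fin 2) i = a} F) →* ℂˣ, ∀ (b : GL (Fin 2) F) (hb : b ∈ (standardParabolicGL F (id : Fin 2 → Fin 2))) (z : ℂ),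
      (Representation.twist (((Representation.trivial ℂ (Π a : Fin 3, GL {i : Fin 3 // (id : Fin 3 → Fin 3) i = a} F) ℂ).twist χ).comp (leviProjection F (id : Fin 3 → Fin 3))) (rootDeltaChar (standardParabolicGL F (id : Fin 3 → Fin 3)))) ⟨(blockDiagonalGL F (![0, 0, 1] : Fin 3 → Fin 2)) (ι b), blockDiagonalGL_iota_mem_borel ι hι hb⟩ z = (Representation.twist (((Representation.trivial ℂ (Π a : Fin 2, GL {i : Fin 2 // (id : Fin 2 → Fin 2) i = a} F) ℂ).twist χ₂).comp (leviProjection F (id : Fin 2 → Fin 2))) (rootDeltaChar (standardParabolicGL F (id : Fin 2 → Fin 2)))) ⟨b, hb⟩ z := by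
  haveI : IsTopologicalRing F := inferInstance
  -- `κ : B₂ →* B₃`, `b ↦ diag(ι b)`
  let κ : ↥(standardParabolicGL F (id : Fin 2 → Fin 2)) →* ↥(standardParabolicGL F (id : Fin 3 → Fin 3)) := (((blockDiagonalGL F (![0, 0, 1] : Fin 3 → Fin 2)).comp ι).comp (standardParabolicGL F (id : Fin 2 → Fin 2)).subtype).codRestrict (standardParabolicGL F (id : Fin 3 → Fin 3)) (fun b => blockDiagonalGL_iota_mem_borel ι hι b.2)
  have hκ : ∀ b : ↥(standardParabolicGL F (id : Fin 2 → Fin 2)), ((κ b : ↥(standardParabolicGL F (id : Fin 3 → Fin 3))) : GL (Fin 3) F) = (blockDiagonalGL F (![0, 0, 1] : Fin 3 → Fin 2)) (ι b) := fun b => rfl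
  let χ₂ : (Π a : Fin 2, GL {i : Fin 2 // (id : Fin 2 → Fin 2) i = a} F) →* ℂˣ := ((χ.comp (leviProjection F (id : Fin 3 → Fin 3))).comp (κ.comp (leviEmbeddingP F (id : Fin 2 → Fin 2)))) *
      ((rootDeltaChar (standardParabolicGL F (id : Fin 3 → Fin 3))).comp (κ.comp (leviEmbeddingP F (id : Fin 2 → Fin 2)))) * ((rootDeltaChar (standardParabolicGL F (id : Fin 2 → Fin 2))).comp (leviEmbeddingP F (id : Fin 2 → Fin 2)))⁻¹
  have hχ₂ : ∀ t, χ₂ t = χ (leviProjection F (id : Fin 3 → Fin 3) (κ (leviEmbeddingP F (id : Fin 2 → Fin 2) t))) *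
      rootDeltaChar (standardParabolicGL F (id : Fin 3 → Fin 3)) (κ (leviEmbeddingP F (id : Fin 2 → Fin 2) t)) * (rootDeltaChar (standardParabolicGL F (id : Fin 2 → Fin 2)) (leviEmbeddingP F (id : Fin 2 → Fin 2) t))⁻¹ := fun t => rfl
  refine ⟨χ₂, fun b hb z => ?_⟩
  -- `⟨b, hb⟩ = emb(t) · u` with `u ∈ U₂`
  obtain ⟨t, u, hu, hbu⟩ : ∃ (t : (Π a : Fin 2, GL {i : Fin 2 // (id : Fin 2 → Fin 2) i = a} F)) (u : ↥(standardParabolicGL F (id : Fin 2 → Fin 2))), u ∈ unipotentRadicalP F (id : Fin 2 → Fin 2) ∧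
      (⟨b, hb⟩ : ↥(standardParabolicGL F (id : Fin 2 → Fin 2))) = leviEmbeddingP F (id : Fin 2 → Fin 2) t * u :=
    ⟨leviProjection F (id : Fin 2 → Fin 2) ⟨b, hb⟩, (leviEmbeddingP F (id : Fin 2 → Fin 2) (leviProjection F (id : Fin 2 → Fin 2) ⟨b, hb⟩))⁻¹ * ⟨b, hb⟩,
      by rw [MonoidHom.mem_ker, map_mul, map_inv, leviProjection_leviEmbeddingP_apply, inv_mul_cancel], by rw [mul_inv_cancel_left]⟩
  have hu2 : ((u : ↥(standardParabolicGL F (id : Fin 2 → Fin 2))) : GL (Fin 2) F) ∈ upperUnitriangular (Fin 2) F := ⟨u, hu, rfl⟩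
  have hκbb : (⟨(blockDiagonalGL F (![0, 0, 1] : Fin 3 → Fin 2)) (ι b), blockDiagonalGL_iota_mem_borel ι hι hb⟩ : ↥(standardParabolicGL F (id : Fin 3 → Fin 3))) = κ ⟨b, hb⟩ := rfl
  -- the unipotent factor is invisible on both sides
  have hσu : (Representation.twist (((Representation.trivial ℂ (Π a : Fin 3, GL {i : Fin 3 // (id : Fin 3 → Fin 3) i = a} F) ℂ).twist χ).comp (leviProjection F (id : Fin 3 → Fin 3))) (rootDeltaChar (standardParabolicGL F (id : Fin 3 → Fin 3)))) (κ u) = 1 :=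
    inducingChar_eq_one_of_mem_upperUnitriangular χ ((blockDiagonalGL F (![0, 0, 1] : Fin 3 → Fin 2)) (ι (u : GL (Fin 2) F))) (blockDiagonalGL_iota_mem_upperUnitriangular ι hι hu2)
  have hτu : (Representation.twist (((Representation.trivial ℂ (Π a : Fin 2, GL {i : Fin 2 // (id : Fin 2 → Fin 2) i = a} F) ℂ).twist χ₂).comp (leviProjection F (id : Fin 2 → Fin 2))) (rootDeltaChar (standardParabolicGL F (id : Fin 2 → Fin 2)))) u = 1 := inducingChar_eq_one_of_mem_upperUnitriangular χ₂ (u : GL (Fin 2) F) hu2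
  rw [hκbb, hbu, map_mul, map_mul, map_mul, hσu, hτu, mul_one, mul_one]
  -- on the torus part: a formal cancellation
  simp only [Representation.twist_apply, MonoidHom.coe_comp, Function.comp_apply, Representation.trivial_apply, leviProjection_leviEmbeddingP_apply,
    hχ₂, Units.val_mul, Units.val_inv_eq_inv_val, smul_eq_mul]
  have hδ : ((rootDeltaChar (standardParabolicGL F (id : Fin 2 → Fin 2)) (leviEmbeddingP F (id : Fin 2 → Fin 2) t) : ℂˣ) : ℂ) ≠ 0 := Units.ne_zero _
  field_simp

set_option maxHeartbeats 800000 in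
include hιc in
/-- **THE CLOSED `(B, P_{(2,1)})`-CELL IN THE `GL₂`-BLOCK NORMAL FORM.**  For `I(χ) = Ind_B^{GL₃}(χδ_B^{1/2})` and a continuous block embedding `ι` (`diag(ι g) = diag(g,1)`)
there are a character `χ₂` of the diagonal torus of `GL₂(F)` and a linear map `Ψ : r_{(2,1)}(I(χ)) → I₂(χ₂) = parabolicIndGL F id (𝟙.twist χ₂)` with
`Ψ[f](g) = f(diag(ι g))`, `GL₂`-equivariant along `ι`, and `Ψ x = 0 ↔ x = [f]` for an `f` vanishing on `P_{(2,1)}` — the shape consumed by ★ (E4b-2■)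
`intertwiningMap_subrepresentation_eq_zero_of_blockMap` with `A = ⊤`. [cite: BernsteinZelevinsky1977, Thm. 5.2] [cite: Casselman1995, §6.3, Prop. 6.3.1] -/
theorem exists_closedCellMap_blockMap :
    ∃ (χ₂ : (Π a : Fin 2, GL {i : Fin 2 // (id : Fin 2 → Fin 2) i = a} F) →* ℂˣ) (Ψ : (restrictUnipotentGL F (![0, 0, 1] : Fin 3 → Fin 2) (smoothIndRep (standardParabolicGL F (id : Fin 3 → Fin 3)) (Representation.twist (((Representation.trivial ℂ (Π a : Fin 3, GL {i : Fin 3 // (id : Fin 3 → Fin 3) i = a} F) ℂ).twist χ).comp (leviProjection F (id : Fin 3 → Fin 3))) (rootDeltaChar (standardParabolicGL F (id : Fin 3 → Fin 3)))))).Coinvariants →ₗ[ℂ] SmoothInd (standardParabolicGL F (id : Fin 2 → Fin 2)) (Representation.twist (((Representation.trivial ℂ (Π a : Fin 2, GL {i : Fin 2 // (id : Fin 2 → Fin 2) i = a} F) ℂ).twist χ₂).comp (leviProjection F (id : Fin 2 → Fin 2))) (rootDeltaChar (standardParabolicGL F (id : Fin 2 → Fin 2))))),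
      (∀ (f : SmoothInd (standardParabolicGL F (id : Fin 3 → Fin 3)) (Representation.twist (((Representation.trivial ℂ (Π a : Fin 3, GL {i : Fin 3 // (id : Fin 3 → Fin 3) i = a} F) ℂ).twist χ).comp (leviProjection F (id : Fin 3 → Fin 3))) (rootDeltaChar (standardParabolicGL F (id : Fin 3 → Fin 3))))) (g : GL (Fin 2) F), (Ψ ((Representation.Coinvariants.mk (restrictUnipotentGL F (![0, 0, 1] : Fin 3 → Fin 2) (smoothIndRep (standardParabolicGL F (id : Fin 3 → Fin 3)) (Representation.twist (((Representation.trivial ℂ (Π a : Fin 3, GL {i : Fin 3 // (id : Fin 3 → Fin 3) i = a} F) ℂ).twist χ).comp (leviProjection F (id : Fin 3 → Fin 3))) (rootDeltaChar (standardParabolicGL F (id : Fin 3 → Fin 3))))))) f)).toFun g = f.toFun ((blockDiagonalGL F (![0, 0, 1] : Fin 3 → Fin 2)) (ι g))) ∧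
      (∀ (g : GL (Fin 2) F) (x : (restrictUnipotentGL F (![0, 0, 1] : Fin 3 → Fin 2) (smoothIndRep (standardParabolicGL F (id : Fin 3 → Fin 3)) (Representation.twist (((Representation.trivial ℂ (Π a : Fin 3, GL {i : Fin 3 // (id : Fin 3 → Fin 3) i = a} F) ℂ).twist χ).comp (leviProjection F (id : Fin 3 → Fin 3))) (rootDeltaChar (standardParabolicGL F (id : Fin 3 → Fin 3)))))).Coinvariants), Ψ (jacquetGL F (![0, 0, 1] : Fin 3 → Fin 2) (smoothIndRep (standardParabolicGL F (id : Fin 3 → Fin 3)) (Representation.twist (((Representation.trivial ℂ (Π a : Fin 3, GL {i : Fin 3 // (id : Fin 3 → Fin 3) i = a} F) ℂ).twist χ).comp (leviProjection F (id : Fin 3 → Fin 3))) (rootDeltaChar (standardParabolicGL F (id : Fin 3 → Fin 3))))) (ι g) x) = (parabolicIndGL F (id : Fin 2 → Fin 2) ((Representation.trivial ℂ (Π a : Fin 2, GL {i : Fin 2 // (id : Fin 2 → Fin 2) i = a} F) ℂ).twist χ₂)) g (Ψ x)) ∧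
      (∀ x : (restrictUnipotentGL F (![0, 0, 1] : Fin 3 → Fin 2) (smoothIndRep (standardParabolicGL F (id : Fin 3 → Fin 3)) (Representation.twist (((Representation.trivial ℂ (Π a : Fin 3, GL {i : Fin 3 // (id : Fin 3 → Fin 3) i = a} F) ℂ).twist χ).comp (leviProjection F (id : Fin 3 → Fin 3))) (rootDeltaChar (standardParabolicGL F (id : Fin 3 → Fin 3)))))).Coinvariants, Ψ x = 0 ↔ ∃ f ∈ (vanishingOn (standardParabolicGL F (id : Fin 3 → Fin 3)) (Representation.twist (((Representation.trivial ℂ (Π a : Fin 3, GL {i : Fin 3 // (id : Fin 3 → Fin 3) i = a} F) ℂ).twist χ).comp (leviProjection F (id : Fin 3 → Fin 3))) (rootDeltaChar (standardParabolicGL F (id : Fin 3 → Fin 3)))) (standardParabolicGL F (![0, 0, 1] : Fin 3 → Fin 2) : Set (GL (Fin 3) F))), (Representation.Coinvariants.mk (restrictUnipotentGL F (![0, 0, 1] : Fin 3 → Fin 2) (smoothIndRep (standardParabolicGL F (id : Fin 3 → Fin 3)) (Representation.twist (((Representation.trivial ℂ (Π a : Fin 3, GL {i : Fin 3 // (id :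 Fin 3 → Fin 3) i = a} F) ℂ).twist χ).comp (leviProjection F (id : Fin 3 → Fin 3))) (rootDeltaChar (standardParabolicGL F (id : Fin 3 → Fin 3))))))) f = x) := by
  haveI : IsTopologicalRing F := inferInstance
  obtain ⟨χ₂, hkey⟩ := exists_blockChar_inducingChar_eq χ ι hι
  -- the Levi-level closed cell map of (E4b-1α)
  obtain ⟨Ψ₀, h1, h2, h3⟩ := exists_closedCellMap (![0, 0, 1] : Fin 3 → Fin 2) (Representation.twist (((Representation.trivial ℂ (Π a : Fin 3, GL {i : Fin 3 // (id : Fin 3 → Fin 3) i = a} F) ℂ).twist χ).comp (leviProjection F (id : Fin 3 → Fin 3))) (rootDeltaChar (standardParabolicGL F (id : Fin 3 → Fin 3)))) K2E3GL3MaximalParabolicRelabel.monotone_twoOne (inducingChar_eq_one_of_mem_upperUnitriangular χ)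
  -- restriction along `ι`: `Ind_{B₃ ∩ M}^{M} → I₂(χ₂)`
  let Λ : SmoothInd ((standardParabolicGL F (id : Fin 3 → Fin 3)).comap (blockDiagonalGL F (![0, 0, 1] : Fin 3 → Fin 2))) ((Representation.twist (((Representation.trivial ℂ (Π a : Fin 3, GL {i : Fin 3 // (id : Fin 3 → Fin 3) i = a} F) ℂ).twist χ).comp (leviProjection F (id : Fin 3 → Fin 3))) (rootDeltaChar (standardParabolicGL F (id : Fin 3 → Fin 3)))).comp ((blockDiagonalGL F (![0, 0, 1] : Fin 3 → Fin 2)).subgroupComap (standardParabolicGL F (id : Fin 3 → Fin 3)))) →ₗ[ℂ] SmoothInd (standardParabolicGL F (id : Fin 2 → Fin 2)) (Representation.twist (((Representation.trivial ℂ (Π a : Fin 2, GL {i : Fin 2 // (id : Fin 2 → Fin 2) i = a} F) ℂ).twist χ₂).comp (leviProjection F (id : Fin 2 → Fin 2))) (rootDeltaChar (standardParabolicGL F (id : Fin 2 → Fin 2)))) :=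
    { toFun := fun φ => by
        refine (⟨⟨fun g => φ.toFun (ι g), ?_⟩, ?_⟩ : ↥(smoothInd (standardParabolicGL F (id : Fin 2 → Fin 2)) (Representation.twist (((Representation.trivial ℂ (Π a : Fin 2, GL {i : Fin 2 // (id : Fin 2 → Fin 2) i = a} F) ℂ).twist χ₂).comp (leviProjection F (id : Fin 2 → Fin 2))) (rootDeltaChar (standardParabolicGL F (id : Fin 2 → Fin 2))))).toSubmodule)
        · rw [mem_indFun_iff]
          intro b g
          rw [map_mul, φ.toFun_subgroup_mul ⟨ι (b : GL (Fin 2) F), Subgroup.mem_comap.2 (blockDiagonalGL_iota_mem_borel ι hι b.2)⟩ (ι g)]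
          exact hkey (b : GL (Fin 2) F) b.2 _
        · refine (indFun (standardParabolicGL F (id : Fin 2 → Fin 2)) (Representation.twist (((Representation.trivial ℂ (Π a : Fin 2, GL {i : Fin 2 // (id : Fin 2 → Fin 2) i = a} F) ℂ).twist χ₂).comp (leviProjection F (id : Fin 2 → Fin 2))) (rootDeltaChar (standardParabolicGL F (id : Fin 2 → Fin 2))))).isSmoothVector_of_le (K := ((smoothIndRep ((standardParabolicGL F (id : Fin 3 → Fin 3)).comap (blockDiagonalGL F (![0, 0, 1] : Fin 3 → Fin 2))) ((Representation.twist (((Representation.trivial ℂ (Π a : Fin 3, GL {i : Fin 3 // (id : Fin 3 → Fin 3) i = a} F) ℂ).twist χ).comp (leviProjection F (id : Fin 3 → Fin 3))) (rootDeltaChar (standardParabolicGL F (id : Fin 3 → Fin 3)))).comp ((blockDiagonalGL F (![0, 0, 1] : Fin 3 → Fin 2)).subgroupComap (standardParabolicGL F (id : Fin 3 → Fin 3))))).stabilizerSubgroup φ).comap ι)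
            ((isSmooth_smoothInd ((standardParabolicGL F (id : Fin 3 → Fin 3)).comap (blockDiagonalGL F (![0, 0, 1] : Fin 3 → Fin 2))) ((Representation.twist (((Representation.trivial ℂ (Π a : Fin 3, GL {i : Fin 3 // (id : Fin 3 → Fin 3) i = a} F) ℂ).twist χ).comp (leviProjection F (id : Fin 3 → Fin 3))) (rootDeltaChar (standardParabolicGL F (id : Fin 3 → Fin 3)))).comp ((blockDiagonalGL F (![0, 0, 1] : Fin 3 → Fin 2)).subgroupComap (standardParabolicGL F (id : Fin 3 → Fin 3)))) φ).preimage hιc) fun u hu => ?_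
          rw [mem_stabilizerSubgroup]
          refine Subtype.ext (funext fun g => ?_)
          rw [indFun_apply_apply]
          change φ.toFun (ι (g * u)) = φ.toFun (ι g)
          have hu' : ι u ∈ (smoothIndRep ((standardParabolicGL F (id : Fin 3 → Fin 3)).comap (blockDiagonalGL F (![0, 0, 1] : Fin 3 → Fin 2))) ((Representation.twist (((Representation.trivial ℂ (Π a : Fin 3, GL {i : Fin 3 // (id : Fin 3 → Fin 3) i = a} F) ℂ).twist χ).comp (leviProjection F (id : Fin 3 → Fin 3))) (rootDeltaChar (standardParabolicGL F (id : Fin 3 → Fin 3)))).comp ((blockDiagonalGL F (![0, 0, 1] : Fin 3 → Fin 2)).subgroupComap (standardParabolicGL F (id : Fin 3 → Fin 3))))).stabilizerSubgroup φ := Subgroup.mem_comap.1 hu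
          rw [mem_stabilizerSubgroup] at hu'
          have := congrArg (fun ψ : SmoothInd ((standardParabolicGL F (id : Fin 3 → Fin 3)).comap (blockDiagonalGL F (![0, 0, 1] : Fin 3 → Fin 2))) ((Representation.twist (((Representation.trivial ℂ (Π a : Fin 3, GL {i : Fin 3 // (id : Fin 3 → Fin 3) i = a} F) ℂ).twist χ).comp (leviProjection F (id : Fin 3 → Fin 3))) (rootDeltaChar (standardParabolicGL F (id : Fin 3 → Fin 3)))).comp ((blockDiagonalGL F (![0, 0, 1] : Fin 3 → Fin 2)).subgroupComap (standardParabolicGL F (id : Fin 3 → Fin 3)))) => ψ.toFun (ι g)) hu'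
          simpa only [toFun_smoothIndRep_apply, map_mul] using this
      map_add' := fun φ ψ => SmoothInd.ext (funext fun g => rfl)
      map_smul' := fun a φ => SmoothInd.ext (funext fun g => rfl) }
  have hΛ : ∀ φ g, (Λ φ).toFun g = φ.toFun (ι g) := fun φ g => rfl
  -- `Λ` is injective: `M = M₁ · ι(GL₂)` and `φ(z·m) = σ′(diag z) φ(m)`
  have hΛinj : ∀ φ, Λ φ = 0 → φ = 0 := by
    intro φ hφ
    refine SmoothInd.ext (funext fun m => ?_)
    obtain ⟨g, z, hz, rfl⟩ := exists_eq_mul_iota ι hι m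
    have hzero : (0 : SmoothInd (standardParabolicGL F (id : Fin 2 → Fin 2)) (Representation.twist (((Representation.trivial ℂ (Π a : Fin 2, GL {i : Fin 2 // (id : Fin 2 → Fin 2) i = a} F) ℂ).twist χ₂).comp (leviProjection F (id : Fin 2 → Fin 2))) (rootDeltaChar (standardParabolicGL F (id : Fin 2 → Fin 2))))).toFun = 0 := by
      have h := SmoothInd.toFun_smul (H := (standardParabolicGL F (id : Fin 2 → Fin 2))) (σ := (Representation.twist (((Representation.trivial ℂ (Π a : Fin 2, GL {i : Fin 2 // (id : Fin 2 → Fin 2) i = a} F) ℂ).twist χ₂).comp (leviProjection F (id : Fin 2 → Fin 2))) (rootDeltaChar (standardParabolicGL F (id : Fin 2 → Fin 2))))) (0 : ℂ) 0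
      rwa [zero_smul, zero_smul] at h
    have hzero' : (0 : SmoothInd ((standardParabolicGL F (id : Fin 3 → Fin 3)).comap (blockDiagonalGL F (![0, 0, 1] : Fin 3 → Fin 2))) ((Representation.twist (((Representation.trivial ℂ (Π a : Fin 3, GL {i : Fin 3 // (id : Fin 3 → Fin 3) i = a} F) ℂ).twist χ).comp (leviProjection F (id : Fin 3 → Fin 3))) (rootDeltaChar (standardParabolicGL F (id : Fin 3 → Fin 3)))).comp ((blockDiagonalGL F (![0, 0, 1] : Fin 3 → Fin 2)).subgroupComap (standardParabolicGL F (id : Fin 3 → Fin 3))))).toFun = 0 := by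
      have h := SmoothInd.toFun_smul (H := ((standardParabolicGL F (id : Fin 3 → Fin 3)).comap (blockDiagonalGL F (![0, 0, 1] : Fin 3 → Fin 2)))) (σ := ((Representation.twist (((Representation.trivial ℂ (Π a : Fin 3, GL {i : Fin 3 // (id : Fin 3 → Fin 3) i = a} F) ℂ).twist χ).comp (leviProjection F (id : Fin 3 → Fin 3))) (rootDeltaChar (standardParabolicGL F (id : Fin 3 → Fin 3)))).comp ((blockDiagonalGL F (![0, 0, 1] : Fin 3 → Fin 2)).subgroupComap (standardParabolicGL F (id : Fin 3 → Fin 3))))) (0 : ℂ) 0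
      rwa [zero_smul, zero_smul] at h
    have h0 : φ.toFun (ι g) = 0 := by
      rw [← hΛ, hφ, hzero, Pi.zero_apply]
    have := φ.toFun_subgroup_mul ⟨z, Subgroup.mem_comap.2 hz⟩ (ι g)
    rw [Subgroup.coe_mk] at this
    rw [this, h0, map_zero, hzero', Pi.zero_apply]
  refine ⟨χ₂, Λ ∘ₗ Ψ₀, fun f g => by rw [LinearMap.comp_apply, hΛ, h1], fun g x => ?_, fun x => ?_⟩
  · rw [LinearMap.comp_apply, LinearMap.comp_apply, h2]
    refine SmoothInd.ext (funext fun g' => ?_)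
    show (Λ (smoothIndRep ((standardParabolicGL F (id : Fin 3 → Fin 3)).comap (blockDiagonalGL F (![0, 0, 1] : Fin 3 → Fin 2))) ((Representation.twist (((Representation.trivial ℂ (Π a : Fin 3, GL {i : Fin 3 // (id : Fin 3 → Fin 3) i = a} F) ℂ).twist χ).comp (leviProjection F (id : Fin 3 → Fin 3))) (rootDeltaChar (standardParabolicGL F (id : Fin 3 → Fin 3)))).comp ((blockDiagonalGL F (![0, 0, 1] : Fin 3 → Fin 2)).subgroupComap (standardParabolicGL F (id : Fin 3 → Fin 3)))) (ι g) (Ψ₀ x))).toFun g' = (smoothIndRep (standardParabolicGL F (id : Fin 2 → Fin 2)) (Representation.twist (((Representation.trivial ℂ (Π a : Fin 2, GL {i : Fin 2 // (id : Fin 2 → Fin 2) i = a} F) ℂ).twist χ₂).comp (leviProjection F (id : Fin 2 → Fin 2))) (rootDeltaChar (standardParabolicGL F (id : Fin 2 → Fin 2)))) g (Λ (Ψ₀ x))).toFun g'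
    rw [hΛ, toFun_smoothIndRep_apply, toFun_smoothIndRep_apply, hΛ, map_mul]
  · rw [LinearMap.comp_apply, ← h3]
    constructor
    · exact hΛinj _
    · intro h
      rw [h, map_zero]

end ClosedCell

end Summit.HodgeConjecture.HodgeConjecture.Cruxes.H413.K2E3GL3BorelInducedJacquetQClosedCellGL2

end
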